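import Mathlib.Topology.Instances.ZMod
import Literature.IUT.HodgeTheaters.TemperedCoveringsSubgraphClosures
import Literature.GroupTheory.CombinatorialGroupTheory.FreeGroupResiduallyFinite
import HarnessLib

/-!
# A free-group model of `StableCurveTemperedData` in which [IUTchI] Cor. 2.3 (ii) and (v) hold — consistency witness

Mochizuki, *Inter-universal Teichmüller theory I*, kurims manuscript (May 2020), §2, Corollary 2.3 (ii),
(v), pp. 47–50 ([IUTchI] Cor 2.3 pp.47-50) [claim: Mochizuki2012, status: disputed].  The typed
predicates `StableCurveTemperedData.Cor23ii`, `Cor23v` (seat abc-iut-L5-t1, `TemperedCoverings.lean`)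
were derived in `TemperedCoveringsSubgraphClosures.lean` (seat abc-iut-L5-d4) from inline hypotheses on
the tempered-vs-profinite interface, themselves kernel-proved for discrete groups in profinite
completions in `TemperedCoveringsDensity.lean`.  This file closes the loop on an HONEST (non-degenerate
on the tempered/profinite axis) inhabitant of the interface: the free group `F₂` (discrete) densely and
INJECTIVELY embedded in its profinite completion `F̂₂` (residual finiteness of free groups, tree
`freeGroup_residuallyFinite`), with "sub-semi-graph" subgroup `Π^tp_ℍ = ⟨x₀⟩ ⊆ Π^tp_𝔾 = F₂` and
`Π̂_ℍ =` its closure; the curve level is taken equal to the graph level (`Δ^tp_X = Π^tp_X = F₂`, `G_k = 1`,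
no cusps).  For this datum `toy` the typed statements `toy.Cor23v` and `toy.Cor23ii` are PROVED — (v)
through M. Hall's theorem (`range_inter_closure_image_of_fg`: `F̂ ∩ G = F` for the finitely generated
`⟨x₀⟩ ≤ F₂`), (ii) through `cor23ii_of_density` — so the (ii)/(v) predicates are satisfiable exactly as
typed by data in which `Π^tp ↪ Π̂` is a genuine dense embedding, and the conditional theorems of the
companion apply to an actual datum.  Nothing here is the arithmetic situation of p. 46 (no curve, no
`[SemiAnbd]` input); record-only, no side taken on [IUTchIII] Cor. 3.12.
-/

namespace Literature.IUT.HodgeTheaters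

namespace StableCurveTemperedData

namespace FreeModel

open Topology Literature.GroupTheory.CombinatorialGroupTheory

/-- The free group on two generators, as a type synonym carrying the DISCRETE topology (the tempered
side `Π^tp_𝔾 = Δ^tp_X = Π^tp_X` of the model). [claim: Mochizuki2012, status: disputed] -/
def F2 : Type := FreeGroup (Fin 2)

/-- The group structure of `F₂`. [folklore] -/
instance : Group F2 := inferInstanceAs (Group (FreeGroup (Fin 2)))

/-- The discrete topology on `F₂`. [folklore] -/
instance : TopologicalSpace F2 := ⊥

/-- `F₂` is discrete. [folklore] -/
instance : DiscreteTopology F2 := ⟨rfl⟩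

/-- The trivial Galois group `G_k = 1` of the model. [claim: Mochizuki2012, status: disputed] -/
abbrev Gk : Type := Multiplicative (ZMod 1)

/-- `F̂₂`, the profinite completion (the profinite side `Π̂_𝔾 = Δ̂_X = Π̂_X` of the model).
[claim: Mochizuki2012, status: disputed] -/
abbrev Hat : Type := profiniteCompletion F2

/-- The canonical map `F₂ → F̂₂` (the "natural injection `Π^tp ↪ Π̂`" of the model).
[claim: Mochizuki2012, status: disputed] -/
@[reducible] noncomputable def ι : F2 →* Hat := toCompletion F2

/-- `F₂ → F̂₂` is injective: free groups are residually finite (tree `freeGroup_residuallyFinite`).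
([IUTchI] §2 p.44) [claim: Mochizuki2012, status: disputed] -/
theorem ι_injective : Function.Injective ι :=
  (ProfiniteGrp.ProfiniteCompletion.etaFn_injective_iff_residuallyFinite (GrpCat.of F2)).mpr
    (freeGroup_residuallyFinite (Fin 2))

/-- The generator `x₀`. [claim: Mochizuki2012, status: disputed] -/
def x0 : F2 := (FreeGroup.of 0 : FreeGroup (Fin 2))

/-- `Π^tp_ℍ := ⟨x₀⟩ ≤ F₂` (a free factor; finitely generated). [claim: Mochizuki2012, status: disputed] -/
def TpH : Subgroup F2 := Subgroup.closure {x0}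

/-- `Π^tp_ℍ` is finitely generated. [claim: Mochizuki2012, status: disputed] -/
theorem tpH_fg : TpH.FG := ⟨{x0}, by rw [TpH, Finset.coe_singleton]⟩

/-- `Π̂_ℍ :=` the closure of `Π^tp_ℍ` in `F̂₂`. [claim: Mochizuki2012, status: disputed] -/
noncomputable def HatH : Subgroup Hat := (TpH.map ι).topologicalClosure

/-- The 𝔾-level data of the model: `Σ = Σ̂ = {3}`, `Π^tp_𝔾 = F₂ ↪ Π̂_𝔾 = F̂₂`, `Π^tp_ℍ = ⟨x₀⟩`,
`Π̂_ℍ = closure`. ([IUTchI] §2 p.44) [claim: Mochizuki2012, status: disputed] -/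
@[reducible] noncomputable def graph : TemperedGraphGroupData.{0} where
  Sigma := {3}
  SigmaHat := {3}
  sigma_subset := subset_rfl
  sigma_nonempty := ⟨3, rfl⟩
  sigmaHat_prime := by
    intro p hp
    rw [Set.mem_singleton_iff] at hp
    subst hp
    exact Nat.prime_three
  Tp := F2
  Hat := Hat
  ι := ι
  ι_continuous := continuous_of_discreteTopology
  ι_injective := ι_injective
  TpH := TpH
  HatH := HatH
  tpH_le := Subgroup.le_topologicalClosure _

/-- **The model datum**: curve level = graph level (`Π^tp_X = Δ^tp_X = F₂`, `Π̂_X = Δ̂_X = F̂₂`,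
`G_k = 1`, residue characteristic `p = 2 ∉ Σ = {3}`), no cusps, one point with decomposition group
everything. ([IUTchI] §2 p.46) [claim: Mochizuki2012, status: disputed] -/
@[reducible] noncomputable def toy : StableCurveTemperedData.{0} where
  graph := graph
  p := 2
  p_notMem := by simp
  PiTp := F2
  PiHat := Hat
  Gk := Gk
  ιX := ι
  ιX_continuous := continuous_of_discreteTopology
  ιX_injective := ι_injective
  prTp := 1
  prHat := 1
  prTp_surjective := fun _ => ⟨1, Subsingleton.elim _ _⟩
  prHat_comp := by ext; exact Subsingleton.elim _ _
  ρTp := (1 : F2 →* Gk).ker.subtype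
  ρHat := (1 : Hat →* Gk).ker.subtype
  ρTp_surjective := fun x => ⟨⟨x, by simp⟩, rfl⟩
  ρHat_surjective := fun x => ⟨⟨x, by simp⟩, rfl⟩
  ρ_comp := fun _ => rfl
  Cusp := Empty
  inertiaTp := fun x => nomatch x
  cuspMeetsH := fun _ => True
  Pt := Unit
  decompTp := fun _ => ⊤

/-! ### The interface facts hold in the model -/

/-- `Π̂_ℍ` is, as a set, the closure of the image of `Π^tp_ℍ`. [claim: Mochizuki2012, status: disputed] -/
theorem coe_hatH : (toy.graph.HatH : Set toy.graph.Hat) = closure (toy.graph.ι '' toy.graph.TpH) := by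
  show ((TpH.map ι).topologicalClosure : Set Hat) = closure (ι '' TpH)
  rw [Subgroup.topologicalClosure_coe, Subgroup.coe_map]

/-- **The 𝔾-level (v), "`F̂ ∩ G = F`", holds in the model**: `Π̂_ℍ ∩ Π^tp_𝔾 = Π^tp_ℍ` in `F̂₂` — by
M. Hall's theorem for the finitely generated `⟨x₀⟩ ≤ F₂` (`range_inter_closure_image_of_fg`).
([IUTchI] Cor 2.3(v) p.49) [claim: Mochizuki2012, status: disputed] -/
theorem hatH_inter_range :
    (toy.graph.HatH : Set toy.graph.Hat) ∩ Set.range toy.graph.ι = toy.graph.ι '' toy.graph.TpH := by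
  rw [coe_hatH, Set.inter_comm]
  exact ProfiniteCompletion.range_inter_closure_image_of_fg (α := Fin 2) TpH tpH_fg

/-- **Cor. 2.3 (v) holds for the model datum**, through `cor23v_of_graph`.
([IUTchI] Cor 2.3(v) p.48) [claim: Mochizuki2012, status: disputed] -/
theorem cor23v : toy.Cor23v := toy.cor23v_of_graph hatH_inter_range

/-- **Cor. 2.3 (ii) holds for the model datum**, through `cor23ii_of_density` (`Δ̂_X = F̂₂` is
Hausdorff, `Δ̂_X = Ker(F̂₂ → 1)` is everything hence closed, `ρ̂` is a subtype inclusion hence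
continuous with trivial kernel, `Π̂_ℍ` is a closure by definition).
([IUTchI] Cor 2.3(ii) p.47) [claim: Mochizuki2012, status: disputed] -/
theorem cor23ii : toy.Cor23ii := by
  refine toy.cor23ii_of_density ?_ continuous_subtype_val coe_hatH ?_
  · show IsClosed (((1 : Hat →* Gk).ker : Subgroup Hat) : Set Hat)
    rw [MonoidHom.ker_one, Subgroup.coe_top]
    exact isClosed_univ
  · intro x hx
    have hx1 : x = 1 := Subtype.ext (by
      rw [SetLike.mem_coe, MonoidHom.mem_ker] at hx
      exact hx)
    subst hx1
    exact subset_closure ⟨⟨1, map_one _⟩, Subgroup.one_mem _⟩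

end FreeModel

end StableCurveTemperedData

end Literature.IUT.HodgeTheaters
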